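import Literature.AlgebraicGeometry.Motives.MixedHodgeStructureStrictProofs
import Mathlib.LinearAlgebra.TensorProduct.Pi
import Mathlib.LinearAlgebra.Pi
import HarnessLib

/-!
# Weights in exact sequences of mixed Hodge structures (exactness of `Gr^W`), and bijective
# morphisms are isomorphisms

Theorems-only sequel to `MixedHodgeStructureStrictProofs` (Deligne's strictness theorem, *Théorie
de Hodge II*, Thm. 2.3.5 (iii), proved there through the splitting `I^{p,q}` of
`MixedHodgeStructureSplitting`). Two standard consequences of strictness, in the element-wise form
in which geometric arguments consume them (Cattani–El Zein–Griffiths–Lê, *Hodge Theory*, Ch. 3,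
Thm. 3.2.18 (Deligne: the category of MHS is abelian) with its proof, p. 161: "A morphism of MHS
which induces an isomorphism on the lattices, is an isomorphism of MHS", and Cor. 3.2.21 (ii): "The
functor `Gr^W_n` from the category of MHS to the category of HS of weight `n` is exact"):

* `Hom.exists_inverse` — a morphism of mixed `ℚ`-Hodge structures whose underlying linear map is
  bijective is an isomorphism: the inverse linear map underlies a morphism (it respects `W` and
  `F` because `f(W_k) = W_k ∩ im f = W_k` and `f_ℂ(F^p) = F^p`, strictness).
* **The weight test** `mem_W_of_forall_map_mem_W` — let `g i : H → H' i` be finitely many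
  morphisms of MHS out of `H` whose joint kernel lies in `W_k H` (in practice: the joint kernel is
  the image of a morphism of MHS `f : H_A → H` with `W_k H_A = H_A`, exactness of
  `H_A → H → ⊕ H' i` at `H`; `iInf_ker_le_W_of_le_range`). Then an element `b ∈ H` with
  `g i b ∈ W_k (H' i)` for every `i` lies in `W_k H`. This is the exactness of `Gr^W_w`, `w > k`,
  on `H_A → H → ⊕ H' i` read on elements (`Gr^W_w H_A = 0` forces `Gr^W_w H ↪ ⊕ Gr^W_w H' i`); it
  is proved here directly from Deligne's splitting, descending on the weight level
  (`mem_W_pred_of_forall_map_mem_W`): modulo `W_{w-1}`, `b` is a sum `s` of elements of the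
  `I^{p,w-p}(H)`; each `g i` maps `s` into `(⊕_p I^{p,w-p}(H' i)) ∩ W_{w-1} = 0`, so `s` lies in the
  complexified joint kernel, hence in `W_{k,ℂ} ⊆ W_{w-1,ℂ}`, and `b ∈ W_{w-1}` by `ℚ`-rationality.
* Corollaries: `W_eq_top_of_forall_W_eq_top` (if the joint kernel lies in `W_k H` and
  `W_k H' i = H' i` for all `i`, then `W_k H = H` — weights `≤ k` pass to the middle term),
  `isPure_of_iInf_ker_eq_bot` (a jointly injective family into pure structures of weight `n` has
  a pure source of weight `n`; e.g. sub-MHS of pure MHS are pure), and the one-morphism forms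
  `mem_W_of_map_mem_W`, `W_eq_top_of_W_eq_top`.

Supporting linear algebra (flatness of `ℂ/ℚ`): `ker_baseChange` (`ker f_ℂ = (ker f)_ℂ`) and
`mem_baseChange_iInf_ker` (the complexified joint kernel of finitely many maps is the joint kernel
of the complexified maps).

These are the abstract inputs of the Mayer–Vietoris/induction-on-dimension arguments on weights of
singular varieties (Deligne, *Théorie de Hodge III*, Thm. 8.2.4 (iii), Prop. 8.2.5: for a resolution
square `F ⊂ X̃ → X ⊃ D` the sequence `Hⁿ⁻¹(F) → Hⁿ(X) → Hⁿ(X̃) ⊕ Hⁿ(D)` is an exact sequence of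
mixed Hodge structures, and the weight test transfers `W_{n-1} Hⁿ⁻¹(F) = Hⁿ⁻¹(F)`,
`W_n Hⁿ(X̃) = Hⁿ(X̃)`, `W_n Hⁿ(D) = Hⁿ(D)` to `W_n Hⁿ(X) = Hⁿ(X)`), cf.
`HodgeTheory/GysinKernelSplitProofs`. Everything here is proved; no definitions, no named facts.

## References

* [DeligneHodgeII1971] P. Deligne, Théorie de Hodge II, Publ. Math. IHÉS 40 (1971), Thm. 1.2.10,
  Thm. 2.3.5.
* [CattaniElZeinGriffithsLe2014] E. Cattani, F. El Zein, P. Griffiths, Lê D. T. (eds.), Hodge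
  Theory, Math. Notes 49, Princeton (2014), Thm. 3.2.18 and its proof, Lemma 3.2.20,
  Cor. 3.2.21 (i)–(ii) (pp. 158–161).
* [DeligneHodgeIII1974] P. Deligne, Théorie de Hodge III, Publ. Math. IHÉS 44 (1974), Thm. 8.2.4,
  Prop. 8.2.5 (context only).
-/

open scoped TensorProduct

noncomputable section

namespace Literature.AlgebraicGeometry.Motives

namespace MixedHodgeStructure

universe u v w w'

variable {V : Type u} [AddCommGroup V] [Module ℚ V]
variable {V' : Type v} [AddCommGroup V'] [Module ℚ V']

/-! ### Flatness of `ℂ/ℚ`: kernels and joint kernels under base change -/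

/-- **`ker (f_ℂ) = (ker f)_ℂ`**: base change to `ℂ` commutes with kernels (left exactness of the
flat extension `ℂ/ℚ`, Mathlib's `Module.Flat.lTensor_exact` applied to `0 → ker f → V → V'`).
[folklore] -/
theorem ker_baseChange (f : V →ₗ[ℚ] V') :
    LinearMap.ker (f.baseChange ℂ) = (LinearMap.ker f).baseChange ℂ := by
  ext x
  have h := Module.Flat.lTensor_exact ℂ (LinearMap.exact_subtype_ker_map f)
  rw [LinearMap.mem_ker]
  constructor
  · intro hx
    have hx' : f.lTensor ℂ x = 0 := by
      rw [← hx]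
      exact (congrFun (LinearMap.baseChange_eq_ltensor (f := f) (A := ℂ)) x).symm
    obtain ⟨y, hy⟩ := (h x).1 hx'
    refine ⟨y, ?_⟩
    rw [← hy]
    exact congrFun (LinearMap.baseChange_eq_ltensor (f := (LinearMap.ker f).subtype) (A := ℂ)) y
  · rintro ⟨y, rfl⟩
    rw [← LinearMap.comp_apply, ← LinearMap.baseChange_comp, LinearMap.comp_ker_subtype,
      LinearMap.baseChange_zero, LinearMap.zero_apply]

/-- **Joint kernels under base change**: if finitely many base-changed maps `(g i)_ℂ` all kill
`x ∈ V_ℂ`, then `x` lies in the base change of the joint kernel `⨅ i, ker (g i)` (the joint kernel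
is the kernel of `V → Π i, U i`, and `ℂ ⊗ Π i, U i ≅ Π i, ℂ ⊗ U i` for finite families, Mathlib's
`TensorProduct.piRight`). [folklore] -/
theorem mem_baseChange_iInf_ker {ι : Type w'} [Finite ι] {U : ι → Type w}
    [∀ i, AddCommGroup (U i)] [∀ i, Module ℚ (U i)] (g : ∀ i, V →ₗ[ℚ] U i)
    {x : ℂ ⊗[ℚ] V} (hx : ∀ i, (g i).baseChange ℂ x = 0) :
    x ∈ (⨅ i, LinearMap.ker (g i)).baseChange ℂ := by
  classical
  haveI := Fintype.ofFinite ι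
  rw [← LinearMap.ker_pi, ← ker_baseChange, LinearMap.mem_ker]
  apply (TensorProduct.piRight ℚ ℂ ℂ U).injective
  rw [map_zero]
  funext i
  rw [TensorProduct.piRight_apply, Pi.zero_apply]
  have key : ∀ z : ℂ ⊗[ℚ] V,
      TensorProduct.piRightHom ℚ ℂ ℂ U ((LinearMap.pi g).baseChange ℂ z) i =
        (g i).baseChange ℂ z := by
    intro z
    induction z using TensorProduct.induction_on with
    | zero => simp only [map_zero, Pi.zero_apply]
    | tmul c v =>
      rw [LinearMap.baseChange_tmul, LinearMap.baseChange_tmul, TensorProduct.piRightHom_tmul]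
      rfl
    | add a b ha hb => rw [map_add, map_add, Pi.add_apply, ha, hb, map_add]
  rw [key, hx i]

/-! ### Bijective morphisms of mixed Hodge structures are isomorphisms -/

section Inverse

variable {H₁ : MixedHodgeStructure V} {H₂ : MixedHodgeStructure V'}

/-- The base change of the underlying map of a morphism with surjective underlying map is
surjective (right exactness of `ℂ ⊗ -`). [folklore] -/
theorem Hom.baseChange_surjective (f : Hom H₁ H₂) (hf : Function.Surjective f.toLinearMap) :
    Function.Surjective (f.toLinearMap.baseChange ℂ) := by
  rw [← LinearMap.range_eq_top, range_baseChange, LinearMap.range_eq_top.2 hf,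
    Submodule.baseChange_top]

/-- **A morphism of mixed Hodge structures with bijective underlying linear map is an
isomorphism of mixed Hodge structures**: the inverse linear map underlies a morphism
`H₂ → H₁` (Cattani–El Zein–Griffiths–Lê, proof of Thm. 3.2.18, p. 161: "A morphism of MHS which
induces an isomorphism on the lattices, is an isomorphism of MHS"). Proof: by strictness
(`Hom.map_W_eq`, `Hom.map_F_eq`) `W_k H₂ = W_k H₂ ∩ im f = f(W_k H₁)` and
`F^p H₂ = f_ℂ(F^p H₁)`, so `f⁻¹` maps `W_k` into `W_k` and `f_ℂ⁻¹ = (f⁻¹)_ℂ` maps `F^p` into `F^p`.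
[cite: CattaniElZeinGriffithsLe2014, Thm. 3.2.18 (proof, p. 161)] -/
theorem Hom.exists_inverse (f : Hom H₁ H₂) (hf : Function.Bijective f.toLinearMap) :
    ∃ g : Hom H₂ H₁,
      g.toLinearMap = ((LinearEquiv.ofBijective f.toLinearMap hf).symm : V' →ₗ[ℚ] V) := by
  set e := LinearEquiv.ofBijective f.toLinearMap hf with he
  have hcomp : (e.symm : V' →ₗ[ℚ] V) ∘ₗ f.toLinearMap = LinearMap.id := by
    ext x
    exact e.symm_apply_apply x
  have hinvC : ∀ z : ℂ ⊗[ℚ] V,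
      (e.symm : V' →ₗ[ℚ] V).baseChange ℂ (f.toLinearMap.baseChange ℂ z) = z := fun z ↦ by
    rw [← LinearMap.comp_apply, ← LinearMap.baseChange_comp, hcomp, LinearMap.baseChange_id,
      LinearMap.id_apply]
  refine ⟨⟨(e.symm : V' →ₗ[ℚ] V), fun k ↦ ?_, fun p ↦ ?_⟩, rfl⟩
  · rintro _ ⟨y, hy, rfl⟩
    have hy' : y ∈ H₂.W k ⊓ LinearMap.range f.toLinearMap := ⟨hy, hf.2 y⟩
    rw [← f.map_W_eq k] at hy'
    obtain ⟨x, hx, rfl⟩ := hy'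
    change e.symm (f.toLinearMap x) ∈ H₁.W k
    rw [show f.toLinearMap x = e x from rfl, e.symm_apply_apply]
    exact hx
  · rintro _ ⟨z, hz, rfl⟩
    have hz' : z ∈ H₂.F p ⊓ LinearMap.range (f.toLinearMap.baseChange ℂ) :=
      ⟨hz, f.baseChange_surjective hf.2 z⟩
    rw [← f.map_F_eq p] at hz'
    obtain ⟨x, hx, rfl⟩ := hz'
    rw [hinvC]
    exact hx

/-- The morphism `H₂ → H₁` underlying the inverse of a bijective morphism `f : H₁ → H₂`
composes with `f` to the identity on elements. [folklore] -/
theorem Hom.exists_inverse_apply (f : Hom H₁ H₂) (hf : Function.Bijective f.toLinearMap) :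
    ∃ g : Hom H₂ H₁, (∀ x, g.toLinearMap (f.toLinearMap x) = x) ∧
      ∀ y, f.toLinearMap (g.toLinearMap y) = y := by
  obtain ⟨g, hg⟩ := f.exists_inverse hf
  refine ⟨g, fun x ↦ ?_, fun y ↦ ?_⟩
  · rw [hg]
    exact (LinearEquiv.ofBijective f.toLinearMap hf).symm_apply_apply x
  · rw [hg]
    exact (LinearEquiv.ofBijective f.toLinearMap hf).apply_symm_apply y

end Inverse

/-! ### The weight test: exactness of `Gr^W` on elements -/

section WeightTest

variable {ι : Type w'} {U : ι → Type w} [∀ i, AddCommGroup (U i)] [∀ i, Module ℚ (U i)]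
variable (H : MixedHodgeStructure V) (H' : ∀ i, MixedHodgeStructure (U i))
  (g : ∀ i, Hom H (H' i))

/-- **One step of the descent.** Let `g i : H → H' i` be finitely many morphisms of MHS whose
joint kernel lies in `W_k H`, and `b ∈ W_w H`, `w > k`, with `g i b ∈ W_k (H' i)` for all `i`.
Then `b ∈ W_{w-1} H`. Proof through Deligne's splitting: `1 ⊗ b = s + b'` with
`s ∈ ⊕_p I^{p,w-p}(H)` and `b' ∈ W_{w-1,ℂ}` (`W_eq_iSup_deligneI_sup`); `(g i)_ℂ s` lies in
`⊕_p I^{p,w-p}(H' i)` (`Hom.map_deligneI_le`) and in `W_{w-1,ℂ}` (it is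
`1 ⊗ g i b - (g i)_ℂ b'`), hence vanishes (`iSup_deligneI_inf_W_pred_eq_bot`); so `s` lies in the
complexified joint kernel (`mem_baseChange_iInf_ker`), inside `W_{k,ℂ} ⊆ W_{w-1,ℂ}`, and
`b ∈ W_{w-1}` by `ℚ`-rationality (`mem_of_one_tmul_mem_baseChange`).
[cite: CattaniElZeinGriffithsLe2014, Cor. 3.2.21 (ii)] -/
theorem mem_W_pred_of_forall_map_mem_W [Finite ι] {k w : ℤ} (hkw : k < w)
    (hker : (⨅ i, LinearMap.ker (g i).toLinearMap) ≤ H.W k) {b : V}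
    (hb : ∀ i, (g i).toLinearMap b ∈ (H' i).W k) (hbw : b ∈ H.W w) : b ∈ H.W (w - 1) := by
  refine mem_of_one_tmul_mem_baseChange _ ?_
  have hbC : (1 : ℂ) ⊗ₜ[ℚ] b ∈ (H.W w).baseChange ℂ := Submodule.tmul_mem_baseChange_of_mem 1 hbw
  rw [H.W_eq_iSup_deligneI_sup w] at hbC
  obtain ⟨s, hs, b', hb', hsb⟩ := Submodule.mem_sup.1 hbC
  -- every `g i` kills `s`
  have hgs : ∀ i, (g i).toLinearMap.baseChange ℂ s = 0 := by
    intro i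
    have h1 : (g i).toLinearMap.baseChange ℂ s ∈ ⨆ p, (H' i).deligneI p (w - p) := by
      have hle : (⨆ p, H.deligneI p (w - p)).map ((g i).toLinearMap.baseChange ℂ) ≤
          ⨆ p, (H' i).deligneI p (w - p) := by
        rw [Submodule.map_iSup]
        exact iSup_mono fun p ↦ (g i).map_deligneI_le p (w - p)
      exact hle ⟨s, hs, rfl⟩
    have h2 : (g i).toLinearMap.baseChange ℂ s ∈ ((H' i).W (w - 1)).baseChange ℂ := by
      have e : (g i).toLinearMap.baseChange ℂ s =
          (g i).toLinearMap.baseChange ℂ ((1 : ℂ) ⊗ₜ[ℚ] b) - (g i).toLinearMap.baseChange ℂ b' := by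
        rw [← hsb, map_add, add_sub_cancel_right]
      rw [e]
      refine Submodule.sub_mem _ ?_ ((g i).map_baseChange_W_le (w - 1) ⟨b', hb', rfl⟩)
      rw [LinearMap.baseChange_tmul]
      exact Submodule.baseChange_mono ℂ ((H' i).monotone_W (show k ≤ w - 1 by omega))
        (Submodule.tmul_mem_baseChange_of_mem 1 (hb i))
    have h3 : (g i).toLinearMap.baseChange ℂ s ∈
        (⨆ p, (H' i).deligneI p (w - p)) ⊓ ((H' i).W (w - 1)).baseChange ℂ := ⟨h1, h2⟩
    rwa [(H' i).iSup_deligneI_inf_W_pred_eq_bot w, Submodule.mem_bot] at h3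
  -- hence `s` lies in the complexified joint kernel, inside `W_{k,ℂ} ⊆ W_{w-1,ℂ}`
  have hsW : s ∈ (H.W (w - 1)).baseChange ℂ :=
    Submodule.baseChange_mono ℂ (hker.trans (H.monotone_W (show k ≤ w - 1 by omega)))
      (mem_baseChange_iInf_ker (fun i ↦ (g i).toLinearMap) hgs)
  rw [← hsb]
  exact Submodule.add_mem _ hsW hb'

/-- **The weight test (exactness of `Gr^W`, element form).** Let `g i : H → H' i` be finitely
many morphisms of mixed Hodge structures whose joint kernel lies in `W_k H` — e.g. the joint
kernel is the image of a morphism of MHS from a structure `H_A` with `W_k H_A = H_A`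
(`iInf_ker_le_W_of_le_range`). If `g i b ∈ W_k (H' i)` for every `i`, then `b ∈ W_k H`. This is
Cor. 3.2.21 (ii) of Cattani–El Zein–Griffiths–Lê ("the functor `Gr^W_n` … is exact"; Deligne,
Hodge II, Thm. 2.3.5) applied in the weights `w > k` to `H_A → H → ⊕ H' i`: there
`Gr^W_w H_A = 0`, so `Gr^W_w H ↪ ⊕ Gr^W_w (H' i)` and the class of `b` dies step by step
(`mem_W_pred_of_forall_map_mem_W`, started at a level `W_t H = H`).
[cite: CattaniElZeinGriffithsLe2014, Cor. 3.2.21 (ii)] [cite: DeligneHodgeII1971, Thm. 2.3.5] -/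
theorem mem_W_of_forall_map_mem_W [Finite ι] {k : ℤ}
    (hker : (⨅ i, LinearMap.ker (g i).toLinearMap) ≤ H.W k) {b : V}
    (hb : ∀ i, (g i).toLinearMap b ∈ (H' i).W k) : b ∈ H.W k := by
  obtain ⟨t, ht⟩ := H.exists_W_eq_top
  have start : b ∈ H.W (k + ((t - k).toNat : ℕ)) := by
    rcases le_or_gt k t with h | h
    · rw [Int.toNat_of_nonneg (show 0 ≤ t - k by omega), add_sub_cancel, ht]
      exact Submodule.mem_top
    · exact H.monotone_W (show t ≤ k + ((t - k).toNat : ℕ) by omega) (ht ▸ Submodule.mem_top)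
  suffices hdesc : ∀ m : ℕ, b ∈ H.W (k + m) → b ∈ H.W k from hdesc _ start
  intro m
  induction m with
  | zero => simp
  | succ m ih =>
    intro hbm
    refine ih ?_
    have h := mem_W_pred_of_forall_map_mem_W H H' g
      (show k < k + ((m + 1 : ℕ) : ℤ) by push_cast; omega) hker hb hbm
    have e : k + ((m + 1 : ℕ) : ℤ) - 1 = k + (m : ℕ) := by push_cast; ring
    rwa [e] at h

/-- **Weights `≤ k` pass to the middle term**: if the joint kernel of the `g i : H → H' i` lies in
`W_k H` and `W_k (H' i) = H' i` for every `i`, then `W_k H = H` (exactness of `Gr^W_w`, `w > k`: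
`0 → Gr^W_w H → ⊕ Gr^W_w H' i = 0`). In Hodge III this is the step "`Hⁿ(X̃)`, `Hⁿ(D)` of weights
`≤ n` and `Hⁿ⁻¹(F)` of weights `≤ n - 1` force `Hⁿ(X)` of weights `≤ n`" of the induction behind
Thm. 8.2.4 (iii). [cite: CattaniElZeinGriffithsLe2014, Cor. 3.2.21 (ii)] -/
theorem W_eq_top_of_forall_W_eq_top [Finite ι] {k : ℤ}
    (hker : (⨅ i, LinearMap.ker (g i).toLinearMap) ≤ H.W k) (htop : ∀ i, (H' i).W k = ⊤) :
    H.W k = ⊤ :=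
  eq_top_iff.2 fun _ _ ↦ mem_W_of_forall_map_mem_W H H' g hker fun i ↦
    (htop i).symm ▸ Submodule.mem_top

/-- **A jointly injective family into pure structures of weight `n` has a pure source of weight
`n`** (e.g. a sub-MHS of a pure Hodge structure is pure of the same weight; the cohomology of a
finite disjoint union of smooth projective varieties, which embeds into the product of the
cohomologies of the pieces, is pure): `W_j H ↪ ⊕ W_j (H' i) = 0` for `j < n`, and the weight
test gives `W_j H = H` for `j ≥ n`. [cite: CattaniElZeinGriffithsLe2014, Cor. 3.2.21 (ii)] -/
theorem isPure_of_iInf_ker_eq_bot [Finite ι] {n : ℤ}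
    (hker : (⨅ i, LinearMap.ker (g i).toLinearMap) = ⊥) (hpure : ∀ i, (H' i).IsPure n) :
    H.IsPure n := by
  refine ⟨fun j hj ↦ ?_, fun j hj ↦ ?_⟩
  · rw [eq_bot_iff]
    intro b hb
    rw [← hker, Submodule.mem_iInf]
    intro i
    rw [LinearMap.mem_ker]
    have h : (g i).toLinearMap b ∈ (H' i).W j := (g i).map_W_le j ⟨b, hb, rfl⟩
    rwa [(hpure i).1 j hj, Submodule.mem_bot] at h
  · exact W_eq_top_of_forall_W_eq_top H H' g (hker.trans_le bot_le) fun i ↦ (hpure i).2 j hj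

/-- **The joint-kernel hypothesis from an exact sequence.** If the joint kernel of the
`g i : H → H' i` is contained in the image of a morphism of MHS `f : H_A → H` with
`W_k H_A = H_A` (exactness of `H_A → H → ⊕ H' i` at `H`, e.g. a Mayer–Vietoris sequence), then it
lies in `W_k H` (`f(W_k H_A) ⊆ W_k H`). [folklore] -/
theorem iInf_ker_le_W_of_le_range {VA : Type*} [AddCommGroup VA] [Module ℚ VA]
    {HA : MixedHodgeStructure VA} (f : Hom HA H) {k : ℤ} (hA : HA.W k = ⊤)
    (hex : (⨅ i, LinearMap.ker (g i).toLinearMap) ≤ LinearMap.range f.toLinearMap) :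
    (⨅ i, LinearMap.ker (g i).toLinearMap) ≤ H.W k := by
  refine hex.trans ?_
  rintro _ ⟨a, rfl⟩
  exact f.map_W_le k ⟨a, hA.symm ▸ Submodule.mem_top, rfl⟩

/-- **The weight test behind Hodge III, Prop. 8.2.5, abstract form.** In an exact sequence of
mixed Hodge structures `H_A →f H →(g i) ⊕ H' i` (joint kernel of the `g i` inside the image of
`f`) with `W_k H_A = H_A`, every `b ∈ H` with `g i b ∈ W_k (H' i)` for all `i` lies in `W_k H`. With
`k = n - 1`, `H_A = Hⁿ⁻¹(F)`, `H = Hⁿ(X)`, `H' = (Hⁿ(X̃), Hⁿ(D))` for a resolution square this is the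
inductive step "a class dying on `X̃` and of weight `≤ n - 1` on `D` has weight `≤ n - 1`".
[cite: CattaniElZeinGriffithsLe2014, Cor. 3.2.21 (ii)] [cite: DeligneHodgeIII1974, Prop. 8.2.5] -/
theorem mem_W_of_exact_of_forall_map_mem_W [Finite ι] {VA : Type*} [AddCommGroup VA]
    [Module ℚ VA] {HA : MixedHodgeStructure VA} (f : Hom HA H) {k : ℤ} (hA : HA.W k = ⊤)
    (hex : (⨅ i, LinearMap.ker (g i).toLinearMap) ≤ LinearMap.range f.toLinearMap) {b : V}
    (hb : ∀ i, (g i).toLinearMap b ∈ (H' i).W k) : b ∈ H.W k :=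
  mem_W_of_forall_map_mem_W H H' g (iInf_ker_le_W_of_le_range H H' g f hA hex) hb

end WeightTest

/-! ### One-morphism forms -/

section OneMap

variable {H₁ : MixedHodgeStructure V} {H₂ : MixedHodgeStructure V'}

/-- **Weight test, one morphism**: if `ker g ⊆ W_k H₁` and `g b ∈ W_k H₂` then `b ∈ W_k H₁`
(the family version with a one-element family). [cite: CattaniElZeinGriffithsLe2014, Cor. 3.2.21 (ii)] -/
theorem mem_W_of_map_mem_W (g : Hom H₁ H₂) {k : ℤ}
    (hker : LinearMap.ker g.toLinearMap ≤ H₁.W k) {b : V} (hb : g.toLinearMap b ∈ H₂.W k) :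
    b ∈ H₁.W k := by
  refine mem_W_of_forall_map_mem_W (ι := Unit) H₁ (fun _ ↦ H₂) (fun _ ↦ g) ?_ fun _ ↦ hb
  rw [iInf_const]
  exact hker

/-- **Weights `≤ k` pass along a morphism with kernel of weights `≤ k`**: `ker g ⊆ W_k H₁` and
`W_k H₂ = H₂` give `W_k H₁ = H₁`. [cite: CattaniElZeinGriffithsLe2014, Cor. 3.2.21 (ii)] -/
theorem W_eq_top_of_W_eq_top (g : Hom H₁ H₂) {k : ℤ}
    (hker : LinearMap.ker g.toLinearMap ≤ H₁.W k) (htop : H₂.W k = ⊤) : H₁.W k = ⊤ :=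
  eq_top_iff.2 fun _ _ ↦ mem_W_of_map_mem_W g hker (htop.symm ▸ Submodule.mem_top)

/-- **An injective morphism into a pure structure has pure source** (sub-MHS of a pure Hodge
structure of weight `n` are pure of weight `n`; Cattani et al., Lemma 3.2.20 with Cor. 3.2.21).
[cite: CattaniElZeinGriffithsLe2014, Lemma 3.2.20] -/
theorem isPure_of_injective (g : Hom H₁ H₂) (hg : Function.Injective g.toLinearMap) {n : ℤ}
    (hpure : H₂.IsPure n) : H₁.IsPure n := by
  refine isPure_of_iInf_ker_eq_bot (ι := Unit) H₁ (fun _ ↦ H₂) (fun _ ↦ g) ?_ fun _ ↦ hpure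
  rw [iInf_const]
  exact LinearMap.ker_eq_bot.2 hg

end OneMap

end MixedHodgeStructure

end Literature.AlgebraicGeometry.Motives

end
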